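import Summits.QuantumAdvantage.AdviceFreeQNC0.CounterStrategies
import HarnessLib

/-!
# Counter strategies IV — the DOOB-WEIGHTED functional `Φ^h` and the window-free theorem refined per final-counter fibre

Planner qa-qnc0-p2 g15, ROUND-15 (p2) §3.15 ADDENDUM 6 (two-sided counters).  p2's trick: replace `Φ(μ) = Σ_b min_L μ(L×{b})` by
`Φ^h(μ) = Σ_b h(b)·min_L μ(L×{b})` with a weight `h_t` that is HARMONIC for the counter's bit chain
(`h_t(b) = ½(h_{t+1}(b) + h_{t+1}(b+1))`): `Φ^h` is still fire-invariant (`phiW_fire`) and bit-monotone (`phiW_bit_le`),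
`ℓ¹`-Lipschitz for `|h| ≤ 1` (`abs_phiW_sub_phiW_le`) and `≥ ⅓·Σ_b h(b)·μ(fibre b)` on label-constant laws (`phiW_ge_third`).
Running p2's six lines of `CounterStrategies` with `Φ^h` gives the window-free theorem REFINED PER FINAL-COUNTER FIBRE
(**`weighted_lose_ge`**): for `3 ∤ p`, every counter strategy mod `p`, every harmonic `0 ≤ h ≤ 1`:
  `Σ_{u LOSES} h_n(W_n(u) mod p) ≥ ⅓·Σ_u h_n(W_n(u) mod p) − 2p·2ⁿ·√(12p/(n+1))`
(the martingale identity `Σ_u h_t(W_{<t}) = Σ_u h_n(W_n)` is `sum_weight_ctrN`).  This is the input of `TwoSidedCounters.lean`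
(a two-sided counter IS a one-sided counter mod `lcm(p,q)` on each fibre `W_n ≡ β (q)`).
WHAT THIS IS NOT: instrument inside the dense residual (adapted strategies); separation NOT moved.
-/

namespace Summit.QuantumAdvantage.AdviceFreeQNC0.CounterLaw

open Finset

variable {p : ℕ}

/-! ## §1 The weighted functional -/

/-- mass of the fibre `{counter = b}`. -/
def fib (μ : St p → ℝ) (b : ZMod p) : ℝ := ∑ g : Bool × Bool, ∑ a : ZMod 3, μ (g, a, b)

section Weighted

variable [NeZero p]

/-- `Φ^w(μ) = Σ_b w(b) · min_{L ∈ 𝓛} μ(L × {b})`. -/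
noncomputable def phiW (w : ZMod p → ℝ) (μ : St p → ℝ) : ℝ :=
  ∑ b : ZMod p, w b * (univ : Finset Idx).inf' ⟨(0, none), mem_univ _⟩ fun i => mass μ i b

/-- **`Φ^w` is `ℓ¹`-Lipschitz** for weights `|w| ≤ 1`. -/
theorem abs_phiW_sub_phiW_le (w : ZMod p → ℝ) (hw : ∀ b, |w b| ≤ 1) (μ ν : St p → ℝ) :
    |phiW w μ - phiW w ν| ≤ l1 μ ν := by
  unfold phiW l1
  rw [← sum_sub_distrib, sum_St]
  refine (abs_sum_le_sum_abs _ _).trans (sum_le_sum fun b _ => ?_)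
  rw [← mul_sub, abs_mul]
  have h := inf'_sub_inf'_le (univ : Finset Idx) ⟨(0, none), mem_univ _⟩ (fun i => mass μ i b) (fun i => mass ν i b) _
    fun i _ => abs_mass_sub_mass_le μ ν i b
  have hnn : 0 ≤ ∑ g : Bool × Bool, ∑ a : ZMod 3, |μ (g, a, b) - ν (g, a, b)| :=
    sum_nonneg fun _ _ => sum_nonneg fun _ _ => abs_nonneg _
  calc |w b| * _ ≤ 1 * ∑ g : Bool × Bool, ∑ a : ZMod 3, |μ (g, a, b) - ν (g, a, b)| :=
        mul_le_mul (hw b) h (abs_nonneg _) zero_le_one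
    _ = _ := one_mul _

/-- **`Φ^w` is invariant under a fibre-wise fire.** -/
theorem phiW_fire (w : ZMod p → ℝ) (μ : St p → ℝ) (F : ZMod p → Bool) :
    phiW w (fun x => μ (if F x.2.2 then tog x.2.1 x.1 else x.1, x.2.1, x.2.2)) = phiW w μ := by
  unfold phiW
  refine sum_congr rfl fun b _ => ?_
  congr 1
  cases hb : F b
  · simp only [mass, hb, if_false, Bool.false_eq_true]
  · have hm : ∀ i, mass (fun x : St p => μ (if F x.2.2 then tog x.2.1 x.1 else x.1, x.2.1, x.2.2)) i b
        = mass μ (togEquiv i) b := by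
      intro i
      show _ = mass μ (togIdx i) b
      rw [← mass_fire]
      simp only [mass, hb, if_true]
    simp only [hm]
    exact inf'_comp_equiv _ togEquiv (fun i => mass μ i b)

/-- **`Φ^w` does not decrease under the bit step when the weight is HARMONIC** (`w b = ½(w' b + w' (b+1))`, `w' ≥ 0`). -/
theorem phiW_bit_le (w w' : ZMod p → ℝ) (hw' : ∀ b, 0 ≤ w' b) (hh : ∀ b, w b = (w' b + w' (b + 1)) / 2)
    (μ : St p → ℝ) :
    phiW w μ ≤ phiW w' (fun x => (μ (x.1, x.2.1 - 1, x.2.2) + μ (x.1, x.2.1 - 2, x.2.2 - 1)) / 2) := by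
  unfold phiW
  set m : ZMod p → ℝ := fun b => univ.inf' ⟨(0, none), mem_univ _⟩ fun i => mass μ i b with hm
  have hsplit : ∀ i b, mass (fun x : St p => (μ (x.1, x.2.1 - 1, x.2.2) + μ (x.1, x.2.1 - 2, x.2.2 - 1)) / 2) i b
      = (mass μ (shIdx 1 i) b + mass μ (shIdx 2 i) (b - 1)) / 2 := by
    intro i b
    rw [← mass_shift μ 1 i b, ← mass_shift μ 2 i (b - 1)]
    unfold mass
    rw [← sum_add_distrib, sum_div]
    refine sum_congr rfl fun g _ => ?_
    rw [← sum_add_distrib, sum_div]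
    refine sum_congr rfl fun a _ => ?_
    split_ifs <;> ring
  have hlow : ∀ b, (m b + m (b - 1)) / 2
      ≤ univ.inf' ⟨(0, none), mem_univ _⟩ (fun i =>
          mass (fun x : St p => (μ (x.1, x.2.1 - 1, x.2.2) + μ (x.1, x.2.1 - 2, x.2.2 - 1)) / 2) i b) := by
    intro b
    refine le_inf' _ _ fun i _ => ?_
    rw [hsplit]
    have h1 : m b ≤ mass μ (shIdx 1 i) b := inf'_le _ (mem_univ _)
    have h2 : m (b - 1) ≤ mass μ (shIdx 2 i) (b - 1) := inf'_le _ (mem_univ _)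
    linarith
  -- reindex the `w' (b+1) · m b` half of the harmonic sum
  have hs : ∑ b : ZMod p, w' b * m (b - 1) = ∑ b : ZMod p, w' (b + 1) * m b := by
    rw [← Equiv.sum_comp (Equiv.addRight (1 : ZMod p)) (fun b => w' b * m (b - 1))]
    refine sum_congr rfl fun b _ => ?_
    simp
  calc ∑ b, w b * m b = ∑ b, (w' b * m b + w' (b + 1) * m b) / 2 := by
        refine sum_congr rfl fun b _ => ?_; rw [hh]; ring
    _ = ∑ b, w' b * ((m b + m (b - 1)) / 2) := by
        rw [← sum_div, sum_add_distrib, ← hs, ← sum_add_distrib, sum_div]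
        refine sum_congr rfl fun b _ => ?_; ring
    _ ≤ _ := sum_le_sum fun b _ => mul_le_mul_of_nonneg_left (hlow b) (hw' b)

/-- **two-block bound, weighted**: nonnegative label-constant laws have `Φ^w(μ) ≥ ⅓·Σ_b w(b)·μ(fibre b)` (`w ≥ 0`). -/
theorem phiW_ge_third (w : ZMod p → ℝ) (hw : ∀ b, 0 ≤ w b) (μ : St p → ℝ) (hμ : ∀ x, 0 ≤ μ x)
    (hconst : ∀ g a b, μ (g, a, b) = μ (g, 0, b)) :
    (∑ b, w b * fib μ b) / 3 ≤ phiW w μ := by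
  unfold phiW
  rw [sum_div]
  refine sum_le_sum fun b _ => ?_
  rw [mul_div_assoc]
  refine mul_le_mul_of_nonneg_left (le_inf' _ _ fun i _ => ?_) (hw b)
  unfold fib mass
  rw [sum_div]
  refine sum_le_sum fun g _ => ?_
  obtain ⟨a₀, ha₀⟩ := exists_mem_idx i g
  have hsum : ∑ a : ZMod 3, μ (g, a, b) = 3 * μ (g, 0, b) := by
    rw [sum_congr rfl fun a _ => hconst g a b, sum_const, card_univ, ZMod.card, nsmul_eq_mul, Nat.cast_ofNat]
  calc (∑ a : ZMod 3, μ (g, a, b)) / 3 = μ (g, a₀, b) := by rw [hsum, hconst g a₀ b]; ring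
    _ = (if mem i g a₀ = true then μ (g, a₀, b) else 0) := by rw [if_pos ha₀]
    _ ≤ ∑ a : ZMod 3, if mem i g a = true then μ (g, a, b) else 0 :=
        single_le_sum (f := fun a => if mem i g a = true then μ (g, a, b) else 0)
          (fun a _ => by split_ifs <;> simp [hμ]) (mem_univ a₀)

/-- the weighted LOSE mass dominates `Φ^w` (`w ≥ 0`). -/
theorem phiW_le_mass_sum (w : ZMod p → ℝ) (hw : ∀ b, 0 ≤ w b) (μ : St p → ℝ) (i₀ : Idx) :
    phiW w μ ≤ ∑ b : ZMod p, w b * mass μ i₀ b :=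
  sum_le_sum fun b _ => mul_le_mul_of_nonneg_left (inf'_le _ (mem_univ i₀)) (hw b)

end Weighted

/-- the averaged law `λ̃` has the same fibres. -/
theorem fib_lam (μ : St p → ℝ) (b : ZMod p) : fib (lam p μ) b = fib μ b := by
  unfold fib lam
  simp only [shK_symm_apply]
  have hp : ((p : ℕ) : ZMod p) = 0 := ZMod.natCast_self p
  have e2 : b - ((2 * p : ℕ) : ZMod p) = b := by push_cast; rw [hp]; ring
  have e3 : b - ((p : ℕ) : ZMod p) = b := by rw [hp, sub_zero]
  simp only [e2, e3]
  have hr : ∀ (k : ZMod 3) (g : Bool × Bool), ∑ a : ZMod 3, μ (g, a - k, b) = ∑ a : ZMod 3, μ (g, a, b) := by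
    intro k g
    exact Equiv.sum_comp (Equiv.subRight k) (fun a => μ (g, a, b))
  refine sum_congr rfl fun g _ => ?_
  rw [← sum_div, sum_add_distrib, sum_add_distrib, hr, hr]; ring

/-! ## §2 Along the process -/

section Process

variable {n : ℕ} (p) (y : Fin (n + 1) → (Fin n → Bool) → Bool)

/-- sums over half-cubes of functions not reading bit `i`. -/
theorem sum_filter_bit_eq_half (i : Fin n) (β : Bool) (F : (Fin n → Bool) → ℝ)
    (hF : ∀ u b, F (Function.update u i b) = F u) :
    ∑ u ∈ univ.filter (fun u : Fin n → Bool => u i = β), F u = (∑ u, F u) / 2 := by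
  have hflip : ∑ u ∈ univ.filter (fun u : Fin n → Bool => u i = β), F u
      = ∑ u ∈ univ.filter (fun u : Fin n → Bool => u i = !β), F u := by
    refine sum_nbij' (fun u => Function.update u i (!β)) (fun u => Function.update u i β) ?_ ?_ ?_ ?_ ?_
    · intro u hu; simp only [mem_filter, mem_univ, true_and] at hu ⊢; simp
    · intro u hu; simp only [mem_filter, mem_univ, true_and] at hu ⊢; simp
    · intro u hu
      simp only [mem_filter, mem_univ, true_and] at hu
      rw [Function.update_idem, ← hu, Function.update_eq_self]
    · intro u hu
      simp only [mem_filter, mem_univ, true_and] at hu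
      rw [Function.update_idem, ← hu, Function.update_eq_self]
    · intro u _; exact (hF u _).symm
  have hsplit : ∑ u, F u = ∑ u ∈ univ.filter (fun u : Fin n → Bool => u i = β), F u
      + ∑ u ∈ univ.filter (fun u : Fin n → Bool => u i = !β), F u := by
    rw [← sum_union]
    · congr 1; ext u
      simp only [mem_univ, mem_union, mem_filter, true_and, true_iff]
      cases u i <;> cases β <;> simp
    · rw [disjoint_filter]
      rintro u _ h1 h2
      rw [h1] at h2; cases β <;> simp at h2
  rw [hsplit, ← hflip]; ring

/-- **martingale step**: a harmonic weight is transported by the counter: `Σ_u w'(W_{<t+1}) = Σ_u w(W_{<t})`. -/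
theorem sum_weight_ctrN_succ (w w' : ZMod p → ℝ) (hh : ∀ b, w b = (w' b + w' (b + 1)) / 2) (t : Fin n) :
    ∑ u : Fin n → Bool, w' (ctrN p u (t.val + 1)) = ∑ u : Fin n → Bool, w (ctrN p u t.val) := by
  have hstep : ∀ u : Fin n → Bool, ctrN p u (t.val + 1) = ctrN p u t.val + ((u t).toNat : ℕ) := by
    intro u; unfold ctrN; rw [wtPrefix_succ_eq]; push_cast; ring
  have hinv : ∀ (u : Fin n → Bool) (b : Bool), ctrN p (Function.update u t b) t.val = ctrN p u t.val := by
    intro u b; unfold ctrN; rw [wtPrefix_update_of_le u t b le_rfl]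
  rw [← sum_filter_add_sum_filter_not univ (fun u : Fin n → Bool => u t = false)]
  have e1 : ∑ u ∈ univ.filter (fun u : Fin n → Bool => u t = false), w' (ctrN p u (t.val + 1))
      = ∑ u ∈ univ.filter (fun u : Fin n → Bool => u t = false), w' (ctrN p u t.val) := by
    refine sum_congr rfl fun u hu => ?_
    simp only [mem_filter, mem_univ, true_and] at hu
    rw [hstep, hu]; simp
  have e2 : ∑ u ∈ univ.filter (fun u : Fin n → Bool => ¬ u t = false), w' (ctrN p u (t.val + 1))
      = ∑ u ∈ univ.filter (fun u : Fin n → Bool => u t = true), w' (ctrN p u t.val + 1) := by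
    have : (univ.filter fun u : Fin n → Bool => ¬ u t = false) = univ.filter fun u : Fin n → Bool => u t = true := by
      congr 1; ext u; simp
    rw [this]
    refine sum_congr rfl fun u hu => ?_
    simp only [mem_filter, mem_univ, true_and] at hu
    rw [hstep, hu]; simp
  rw [e1, e2, sum_filter_bit_eq_half t false (fun u => w' (ctrN p u t.val)) (fun u b => by simp only [hinv]),
    sum_filter_bit_eq_half t true (fun u => w' (ctrN p u t.val + 1)) (fun u b => by simp only [hinv]),
    ← add_div, ← sum_add_distrib, sum_div]
  exact sum_congr rfl fun u _ => (hh _).symm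

/-- the martingale identity iterated: `Σ_u h_t(W_{<t}) = Σ_u h_s(W_{<s})` for `t ≤ s ≤ n`. -/
theorem sum_weight_ctrN (h : ℕ → ZMod p → ℝ) (hh : ∀ t < n, ∀ b, h t b = (h (t + 1) b + h (t + 1) (b + 1)) / 2)
    {t s : ℕ} (hts : t ≤ s) (hs : s ≤ n) :
    ∑ u : Fin n → Bool, h t (ctrN p u t) = ∑ u : Fin n → Bool, h s (ctrN p u s) := by
  induction s, hts using Nat.le_induction with
  | base => rfl
  | succ s hts ih =>
    have hsn : s < n := hs
    rw [ih hsn.le]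
    exact (sum_weight_ctrN_succ p (h s) (h (s + 1)) (hh s hsn) ⟨s, hsn⟩).symm

/-- fibre masses of `lawP t` count the inputs by their counter. -/
theorem fib_lawP (t : ℕ) (b : ZMod p) :
    fib (lawP p y t) b = ((univ.filter fun u : Fin n → Bool => ctrN p u t = b).card : ℝ) := by
  unfold fib lawP
  have hfib := card_eq_sum_card_fiberwise (s := univ.filter fun u : Fin n → Bool => ctrN p u t = b)
    (t := (univ : Finset ((Bool × Bool) × ZMod 3)))
    (f := fun u => ((Xp p y u t).1, (Xp p y u t).2.1)) (fun u _ => mem_univ _)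
  rw [hfib, Nat.cast_sum, Fintype.sum_prod_type (f := fun ga : (Bool × Bool) × ZMod 3 =>
    (((univ.filter fun u : Fin n → Bool => ctrN p u t = b).filter fun u => ((Xp p y u t).1, (Xp p y u t).2.1) = ga).card : ℝ))]
  refine sum_congr rfl fun g _ => sum_congr rfl fun a _ => ?_
  congr 2
  ext u
  simp only [mem_filter, mem_univ, true_and, Xp, Prod.mk.injEq]
  tauto

variable [NeZero p]

/-- `Σ_b w(b)·(fibre mass) = Σ_u w(W_{<t}(u))`. -/
theorem sum_weight_fib_lawP (w : ZMod p → ℝ) (t : ℕ) :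
    ∑ b, w b * fib (lawP p y t) b = ∑ u : Fin n → Bool, w (ctrN p u t) := by
  simp only [fib_lawP]
  rw [← Finset.sum_fiberwise (univ : Finset (Fin n → Bool)) (fun u : Fin n → Bool => ctrN p u t)
    (fun u : Fin n → Bool => w (ctrN p u t))]
  refine sum_congr rfl fun b _ => ?_
  rw [sum_congr rfl fun u hu => by rw [(mem_filter.mp hu).2], sum_const, nsmul_eq_mul, mul_comm]

/-- the weighted LOSE count as a weighted mass of the final law. -/
theorem sum_weight_mass_lose
    (hy : ∀ g : Fin (n + 1), ∀ u v : Fin n → Bool, wtPrefix u g.val % p = wtPrefix v g.val % p → y g u = y g v)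
    (c : ℕ) (w : ZMod p → ℝ) :
    ∑ b, w b * mass (lawP p y n) (((n : ℕ) : ZMod 3) - c, none) b
      = ∑ u : Fin n → Bool, if ringWinU c y u = false then w (ctrN p u n) else 0 := by
  set i₀ : Idx := (((n : ℕ) : ZMod 3) - c, none)
  set F : St p → ℝ := fun x => if mem i₀ x.1 x.2.1 = true then w x.2.2 else 0 with hF
  have h1 : ∀ u : Fin n → Bool, (if ringWinU c y u = false then w (ctrN p u n) else 0) = F (Xp p y u n) := by
    intro u
    have hiff := lose_iff p y hy c u
    have e3 : (Xp p y u n).2.2 = ctrN p u n := rfl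
    simp only [hF, e3]
    by_cases hL : ringWinU c y u = false
    · rw [if_pos hL, if_pos (hiff.mp hL)]
    · rw [if_neg hL, if_neg (fun h => hL (hiff.mpr h))]
  simp only [h1]
  rw [← Finset.sum_fiberwise (univ : Finset (Fin n → Bool)) (fun u : Fin n → Bool => Xp p y u n)
    (fun u : Fin n → Bool => F (Xp p y u n))]
  have h2 : ∀ x : St p, ∑ u ∈ univ.filter (fun u : Fin n → Bool => Xp p y u n = x), F (Xp p y u n) = lawP p y n x * F x := by
    intro x
    rw [sum_congr rfl fun u hu => by rw [(mem_filter.mp hu).2], sum_const, nsmul_eq_mul]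
    rfl
  simp only [h2]
  rw [sum_St]
  refine sum_congr rfl fun b _ => ?_
  unfold mass
  rw [mul_sum]
  refine sum_congr rfl fun g _ => ?_
  rw [mul_sum]
  refine sum_congr rfl fun a _ => ?_
  simp only [hF]
  split_ifs <;> ring

/-- **(5), weighted**: `Φ^{h_t}(lawP_t) ≤ Φ^{h_s}(lawP_s)` for `t ≤ s ≤ n` and harmonic `h ≥ 0`. -/
theorem phiW_lawP_mono (h : ℕ → ZMod p → ℝ) (hh : ∀ t < n, ∀ b, h t b = (h (t + 1) b + h (t + 1) (b + 1)) / 2)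
    (h0 : ∀ t b, 0 ≤ h t b) {t s : ℕ} (hts : t ≤ s) (hs : s ≤ n) :
    phiW (h t) (lawP p y t) ≤ phiW (h s) (lawP p y s) := by
  induction s, hts using Nat.le_induction with
  | base => exact le_rfl
  | succ s hts ih =>
    have hsn : s < n := hs
    refine (ih hsn.le).trans ?_
    have hbit : phiW (h s) (lawP p y s) ≤ phiW (h (s + 1)) (law p y (s + 1)) := by
      have hb := phiW_bit_le (h s) (h (s + 1)) (h0 (s + 1)) (hh s hsn) (lawP p y s)
      have e : (fun x : St p => (lawP p y s (x.1, x.2.1 - 1, x.2.2) + lawP p y s (x.1, x.2.1 - 2, x.2.2 - 1)) / 2)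
          = law p y (s + 1) := by
        funext x; exact (law_succ p y ⟨s, hsn⟩ x).symm
      rwa [e] at hb
    have hfire : phiW (h (s + 1)) (lawP p y (s + 1)) = phiW (h (s + 1)) (law p y (s + 1)) := by
      have e : lawP p y (s + 1) = fun x : St p =>
          law p y (s + 1) (if tabN p y (s + 1) x.2.2 then tog x.2.1 x.1 else x.1, x.2.1, x.2.2) := by
        funext x; exact lawP_eq p y (s + 1) x
      rw [e]; exact phiW_fire (h (s + 1)) (law p y (s + 1)) (tabN p y (s + 1))
    rw [hfire]; exact hbit

/-- **THE FIBRE-REFINED WINDOW-FREE THEOREM**: for `3 ∤ p`, every counter strategy mod `p` and every harmonic weight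
`0 ≤ h ≤ 1`: `Σ_{u LOSES} h_n(W_n(u)) ≥ ⅓·Σ_u h_n(W_n(u)) − 2p·2ⁿ·√(12p/(n+1))`. -/
theorem weighted_lose_ge (h3 : ¬ 3 ∣ p)
    (hy : ∀ g : Fin (n + 1), ∀ u v : Fin n → Bool, wtPrefix u g.val % p = wtPrefix v g.val % p → y g u = y g v)
    (c : ℕ) (h : ℕ → ZMod p → ℝ) (hh : ∀ t < n, ∀ b, h t b = (h (t + 1) b + h (t + 1) (b + 1)) / 2)
    (h0 : ∀ t b, 0 ≤ h t b) (h1 : ∀ t b, h t b ≤ 1) :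
    (∑ u : Fin n → Bool, h n (ctrN p u n)) / 3 - 2 * p * (2 : ℝ) ^ n * Real.sqrt (12 * p / (n + 1))
      ≤ ∑ u : Fin n → Bool, if ringWinU c y u = false then h n (ctrN p u n) else 0 := by
  have hp : (0 : ℝ) < p := by exact_mod_cast NeZero.pos p
  have hRHS : 0 ≤ ∑ u : Fin n → Bool, if ringWinU c y u = false then h n (ctrN p u n) else 0 :=
    sum_nonneg fun u _ => by split_ifs <;> simp [h0]
  have hsum_le : ∑ u : Fin n → Bool, h n (ctrN p u n) ≤ (2 : ℝ) ^ n := by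
    calc ∑ u : Fin n → Bool, h n (ctrN p u n) ≤ ∑ _u : Fin n → Bool, (1 : ℝ) := sum_le_sum fun u _ => h1 _ _
      _ = (2 : ℝ) ^ n := by simp
  by_cases hn : 12 * p < n + 1
  · obtain ⟨t, ht, hD⟩ := exists_D1_le p y hn
    set μ := lawP p y t with hμ
    -- (6) LOSE mass ≥ Φ^{h_n}(lawP n) ≥ Φ^{h_t}(lawP t)
    have hA : phiW (h t) μ ≤ ∑ u : Fin n → Bool, if ringWinU c y u = false then h n (ctrN p u n) else 0 := by
      rw [← sum_weight_mass_lose p y hy c (h n)]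
      exact (phiW_lawP_mono p y h hh h0 ht.le le_rfl).trans (phiW_le_mass_sum (h n) (h0 n) _ _)
    -- (4) Φ^{h_t}(λ̃) ≥ ⅓ Σ_u h_t(W_{<t}) = ⅓ Σ_u h_n(W_n)
    have hB : (∑ u : Fin n → Bool, h n (ctrN p u n)) / 3 ≤ phiW (h t) (lam p μ) := by
      rw [← sum_weight_ctrN p h hh ht.le le_rfl, ← sum_weight_fib_lawP p y (h t) t]
      have e : ∑ b, h t b * fib (lawP p y t) b = ∑ b, h t b * fib (lam p μ) b :=
        sum_congr rfl fun b _ => by rw [fib_lam]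
      rw [e]
      refine phiW_ge_third (h t) (h0 t) _ (fun x => ?_) (fun g a b => lam_const p h3 _ g a b)
      have hl := lawP_nonneg p y t
      exact div_nonneg (add_nonneg (add_nonneg (hl _) (hl _)) (hl _)) (by norm_num)
    -- (3) Lipschitz + ‖μ − λ̃‖₁ ≤ p·D1
    have hC : |phiW (h t) μ - phiW (h t) (lam p μ)| ≤ l1 μ (lam p μ) :=
      abs_phiW_sub_phiW_le (h t) (fun b => by rw [abs_of_nonneg (h0 t b)]; exact h1 t b) _ _
    have hl := l1_lam_le p μ
    rw [abs_le] at hC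
    have hpD : (p : ℝ) * D1 p μ ≤ p * (2 * (2 : ℝ) ^ n * Real.sqrt (12 * p / (n + 1))) :=
      mul_le_mul_of_nonneg_left hD hp.le
    linarith [hC.1]
  · have h1' : 1 ≤ Real.sqrt (12 * p / (n + 1)) := by
      rw [Real.one_le_sqrt, one_le_div (by positivity)]
      exact_mod_cast not_lt.mp hn
    have hM : (0 : ℝ) < (2 : ℝ) ^ n := pow_pos (by norm_num) n
    have hp1 : (1 : ℝ) ≤ p := by exact_mod_cast NeZero.pos p
    have : (2 : ℝ) ^ n ≤ 2 * p * (2 : ℝ) ^ n * Real.sqrt (12 * p / (n + 1)) := by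
      have e : 2 * p * (2 : ℝ) ^ n * Real.sqrt (12 * p / (n + 1)) = (2 : ℝ) ^ n * (2 * (p * Real.sqrt (12 * p / (n + 1)))) := by
        ring
      rw [e]
      have hps : (1 : ℝ) ≤ p * Real.sqrt (12 * p / (n + 1)) := by
        have := mul_le_mul hp1 h1' zero_le_one hp.le
        rwa [one_mul] at this
      nlinarith
    linarith

end Process

end Summit.QuantumAdvantage.AdviceFreeQNC0.CounterLaw
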